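import Summits.BirchSwinnertonDyer.Rank1Residual.Additive.SharpenedStatements
import Literature.NumberTheory.EllipticCurves.Fouquet2024.OrdinaryFibreRankZeroBSD
import Literature.NumberTheory.EllipticCurves.Rank1Residual.Typed.Basic
import Literature.NumberTheory.EllipticCurves.ComplexMultiplicationBurungaleFlachProofs
import Literature.NumberTheory.EllipticCurves.AnalyticRankOrderProofs
import HarnessLib

/-!
# Route `KatoDescentTamePotSupersingular` (rung K8-t′, cell `bsd-potss`): the FOUQUET-2024 ORDINARY-FIBRE road, R2′-CORRECTED —
# L₀ and BSD_p on the (t′) rank-0 rows of ordinary residual shape at `p ≥ 5` WITH `A_Σ = 1` (no bad prime `ℓ ≠ p` of `W` with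
# `ℓ ≡ 1 (mod p)`), from Fouquet, Publ. Math. Besançon 2024 Thm 1.1 (iv)⇒(ii) + Prop. 3.9
# (a `--supports … --as helper` file; items 19618 `TameLowerIntrinsicNonCM` / 19981 `TameLowerHalfRankZero`; seat bsd-potss-k8t-c2 g12)

WHY THIS FILE (companion of `…TameLowerFouquetFibreRoad.lean`, p520558, seat g11; that file is at the 400-line cap, hence a new
module rather than an append). AUDIT R2′ of g11's reading R2 (memo HOME/k8t-c2/g12/FINDING-19981-pmb2024-fibre-audit-k8t-c2-g12.md;
docstring section R2′ of `Literature/…/Fouquet2024/OrdinaryFibreRankZeroBSD.lean`, p525876): Fouquet's fibre is taken over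
`Λ = O[[X₁,X₂,X₃]]` (journal pp. 25, 29, 36, 38) and `R_Σ(ρ̄) ≃ R^χ_Σ(ρ̄) ⊗̂ R_Σ(𝟙)` with `R_Σ(𝟙) ≅ O[[X₁]] ⊗ O[A_Σ]`,
`A_Σ = ∏_{ℓ ∈ Σ∖{p}} (ℤ/(ℓ−1)ℤ) ⊗ ℤ_p` (p. 26); so the fibre of the nearly-ordinary point holds, besides the trivial-character
ordinary forms of R2, their twists by the `p`-power-order characters of conductor supported on `{ℓ ∈ Σ : ℓ ≡ 1 (mod p)}` — forms
of NON-trivial nebentypus, outside Skinner–Urban Thm 3.6.4 («`χ = 1`», Invent. Math. 195 p. 43) and outside every published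
main conjecture this seat could locate. Hypothesis (iv) of Thm 1.1 is therefore discharged by R2–R3 exactly when `A_Σ = 1`. The
twins `Fouquet2024.padicValRat_bsd_rank_zero_of_ordinaryFibre{_ellipticShape,}_levelNotOneModP` (p525876) add the binder
`∀ ℓ, ℓ.Prime → ℓ ∣ N_W → ℓ ≠ p → ¬ p ∣ ℓ − 1` (`Σ` = primes of `p N_W`); this file is §1–§3 of the companion over them, verbatim
otherwise, plus the one-line implications (A) ⇒ (A′), (B) ⇒ (B′):

* §1 the implications; §2 per pair + row forms over (A′) («FibreRowA′» = FibreRowA ∧ the binder); §3 per pair + row forms over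
  (B′) («FibreRowB′», SEED-FREE). Skeleton v7 proposal (planner's call): HOME/k8t-c2/g12/lean/TameLowerIntrinsicNonCM_birth_v7_proposal.lean.

CENSUS (cell `(5; II*, v₅(c₄) = 4)`, 700 rank-0 rows `< 5·10⁵`; HOME/k8t-c2/g12/census/PMB2024-FIBRE-ASIGMA-rows700-k8t-c2-g12.tsv,
sha16 0b8f136ab2f6f974): (B′) 174 of the 276 fact-(B) rows (34 of 46 content rows `25 ∣ #Ш_an`; 8 of them with no elliptic
good-ordinary partner below `5·10⁵`), (A′) 148 of 242 (26 of 37). Of the 12 content rows leaving the fibre roads, 11 stay at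
refereed-citation tier through the 2025 single-point road (tier A, p452337/p462359), one (317075h1) returns to the Kurihara lane.

HONEST FRAMING: conditional on cite-level reading facts (no `_holds`: `R = T`, Nakamura's zeta morphism, Skinner–Urban's Eisenstein
congruences are programme-sized); readings R0, R1, R2′, R3–R6 are offered to the cell referee; items 19618 / 19981 are NOT closed
(Kato's Conj. 12.10 lower inclusion at an additive potentially supersingular prime stays open off these rows); nothing is booked;
BSD is not proved by any of this.

ROUTE-INDEPENDENT (lint `theses-cone`): imports neither the route file nor the route's Defs (same cone as the companion).

References: [Fouquet2024CongruencesIMC] Thm 1.1 (p. 24), Thm 2.1 proof (pp. 26–28), fibre (p. 29), Prop. 3.9 (p. 33), rank `d` (p. 36),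
§4.1 (p. 38), §4.2 (pp. 39–40); [Nakamura2023ZetaMorphisms] Thm 1.1; [SkinnerUrban2014] Thm 3.6.4 (p. 43); [Kato2004Asterisque] §17.13
(pp. 279–280); [WZhang2014] p. 232; [Miller2011LMS] Def. 1.1.
-/

set_option autoImplicit false
-- sibling precedent (`KatoDescentTamePotSupersingularTameLowerFouquetFibreRoad.lean`): the directory name repeats the summit name
set_option linter.dupNamespace false

noncomputable section

open scoped Classical

namespace Summit.BirchSwinnertonDyer.BirchSwinnertonDyer.Theorems

open WeierstrassCurve Literature.NumberTheory.EllipticCurves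
  Literature.NumberTheory.EllipticCurves.Rank1Residual
  Literature.NumberTheory.EllipticCurves.Rank1Residual.Typed
  Summit.BirchSwinnertonDyer.Rank1Residual.Additive
  Summit.BirchSwinnertonDyer.Rank1Residual

/-! ## §1 The implications (A) ⇒ (A′), (B) ⇒ (B′); §2 the road over fact (A′) («FibreRowA′» = FibreRowA ∧ the R2′ binder) -/

/-- (A′) is implied by (A): one hypothesis more. [cite: Fouquet2024CongruencesIMC, Thm 1.1 (p. 24)] -/
theorem fouquetFibreShape_levelNotOneModP_of_fact
    (hA : Fouquet2024.padicValRat_bsd_rank_zero_of_ordinaryFibre_ellipticShape) :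
    Fouquet2024.padicValRat_bsd_rank_zero_of_ordinaryFibre_ellipticShape_levelNotOneModP :=
  fun W G _ _ _ _ p _ hp hsurj hram _ hgood hap hnak hcong hL hfin =>
    hA W G p hp hsurj hram hgood hap hnak hcong hL hfin

/-- (B′) is implied by (B): one hypothesis more. [cite: Fouquet2024CongruencesIMC, Thm 1.1 (p. 24)] -/
theorem fouquetFibreLine_levelNotOneModP_of_fact (hB : Fouquet2024.padicValRat_bsd_rank_zero_of_ordinaryFibre) :
    Fouquet2024.padicValRat_bsd_rank_zero_of_ordinaryFibre_levelNotOneModP :=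
  fun W _ _ p _ hp hsurj hram _ hline hL hfin => hB W p hp hsurj hram hline hL hfin

section ShapeWitnessPrime

variable (W G : WeierstrassCurve ℚ) [W.IsElliptic] [W.IsGloballyMinimal] [G.IsElliptic] [G.IsGloballyMinimal]
  (p : ℕ) [Fact p.Prime]

/-- **Bridge (definitional) over fact (A′): print shape of the `p`-part of BSD in rank `0`** for `W` (any reduction at
`p ≥ 5`) with `ρ̄_{W,p}` onto, a Steinberg prime `q ≢ ±1 (mod p)` with `p ∤ v_q(Δ_W)`, NO bad prime `ℓ ≠ p` with
`ℓ ≡ 1 (mod p)` (R2′: `A_Σ = 1`), and a congruent good-ordinary shape witness `G` with `p ∤ a_p(G)² − 1`. Conditional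
on the cite-level fact `hA`; nothing credited. [cite: Fouquet2024CongruencesIMC, Thm 1.1 (iv)⇒(ii) (p. 24), fibre (p. 29), Prop. 3.9 (p. 33), §4.1 (p. 38)]
[cite: SkinnerUrban2014, Thm 3.6.4 (p. 43)] -/
theorem pPartRankZero_of_fouquetFibreShape_levelNotOneModP
    (hA : Fouquet2024.padicValRat_bsd_rank_zero_of_ordinaryFibre_ellipticShape_levelNotOneModP) (hp : 5 ≤ p)
    (hsurj : Surj W p)
    (hram : ∃ ℓ : ℕ, ∃ _ : Fact ℓ.Prime, ℓ ≠ p ∧ W.HasMultiplicativeReductionAtPrime ℓ ∧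
      ¬ p ∣ padicValInt ℓ W.minimalDiscriminantInt ∧ ¬ p ∣ ℓ - 1 ∧ ¬ p ∣ ℓ + 1)
    (hlev : ∀ ℓ : ℕ, ℓ.Prime → ℓ ∣ W.conductorNorm ℤ → ℓ ≠ p → ¬ p ∣ ℓ - 1)
    (hord : GoodOrd G p) (hnak : ¬ (p : ℤ) ∣ (G.frobeniusTrace p) ^ 2 - 1)
    (hcong : ∀ ℓ : ℕ, ℓ.Prime → ¬ (ℓ ∣ p * W.conductorNorm ℤ * G.conductorNorm ℤ) →
      ((W.LFunction ℓ : ℤ) : ZMod p) = ((G.LFunction ℓ : ℤ) : ZMod p))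
    (hL : W.entireLFunction 1 ≠ 0) (hfin : Finite W.sha) : PPartRankZero W p :=
  hA W G p hp hsurj hram hlev hord.1 hord.2 hnak hcong hL hfin

/-- **Both typed halves `MissingPPartAt W p` over fact (A′)** (+ modularity + GZK). Conditional; nothing credited.
[cite: Fouquet2024CongruencesIMC, Thm 1.1 (p. 24) and Prop. 3.9 (p. 33)] [cite: Miller2011LMS, Def. 1.1] -/
theorem missingPPartAt_rankZero_of_fouquetFibreShape_levelNotOneModP
    (hA : Fouquet2024.padicValRat_bsd_rank_zero_of_ordinaryFibre_ellipticShape_levelNotOneModP)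
    (hmod : hasEntireLFunction_rat) (hGZK : rank_eq_analyticRank_of_analyticRank_le_one) (hp : 5 ≤ p)
    (hr : W.analyticRank = 0) (hsurj : Surj W p)
    (hram : ∃ ℓ : ℕ, ∃ _ : Fact ℓ.Prime, ℓ ≠ p ∧ W.HasMultiplicativeReductionAtPrime ℓ ∧
      ¬ p ∣ padicValInt ℓ W.minimalDiscriminantInt ∧ ¬ p ∣ ℓ - 1 ∧ ¬ p ∣ ℓ + 1)
    (hlev : ∀ ℓ : ℕ, ℓ.Prime → ℓ ∣ W.conductorNorm ℤ → ℓ ≠ p → ¬ p ∣ ℓ - 1)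
    (hord : GoodOrd G p) (hnak : ¬ (p : ℤ) ∣ (G.frobeniusTrace p) ^ 2 - 1)
    (hcong : ∀ ℓ : ℕ, ℓ.Prime → ¬ (ℓ ∣ p * W.conductorNorm ℤ * G.conductorNorm ℤ) →
      ((W.LFunction ℓ : ℤ) : ZMod p) = ((G.LFunction ℓ : ℤ) : ZMod p)) :
    MissingPPartAt W p := by
  haveI hfin : Finite W.sha := (hGZK W (by omega)).2
  have hL : W.entireLFunction 1 ≠ 0 := by
    rw [← W.leadingLCoeff_eq_of_analyticRank_eq_zero hr]
    exact W.leadingLCoeff_ne_zero_holds (hmod W)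
  exact missingPPartAt_of_bsdp W p
    (bsdp_of_pPartRankZero W p hmod hGZK hr
      (pPartRankZero_of_fouquetFibreShape_levelNotOneModP W G p hA hp hsurj hram hlev hord hnak hcong hL hfin))

/-- **The crux's currency `MissingLowerBoundAt W p` over fact (A′).** Conditional; items NOT closed.
[cite: Fouquet2024CongruencesIMC, Thm 1.1 (p. 24)] [cite: Miller2011LMS, Def. 1.1] -/
theorem missingLowerBoundAt_rankZero_of_fouquetFibreShape_levelNotOneModP
    (hA : Fouquet2024.padicValRat_bsd_rank_zero_of_ordinaryFibre_ellipticShape_levelNotOneModP)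
    (hmod : hasEntireLFunction_rat) (hGZK : rank_eq_analyticRank_of_analyticRank_le_one) (hp : 5 ≤ p)
    (hr : W.analyticRank = 0) (hsurj : Surj W p)
    (hram : ∃ ℓ : ℕ, ∃ _ : Fact ℓ.Prime, ℓ ≠ p ∧ W.HasMultiplicativeReductionAtPrime ℓ ∧
      ¬ p ∣ padicValInt ℓ W.minimalDiscriminantInt ∧ ¬ p ∣ ℓ - 1 ∧ ¬ p ∣ ℓ + 1)
    (hlev : ∀ ℓ : ℕ, ℓ.Prime → ℓ ∣ W.conductorNorm ℤ → ℓ ≠ p → ¬ p ∣ ℓ - 1)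
    (hord : GoodOrd G p) (hnak : ¬ (p : ℤ) ∣ (G.frobeniusTrace p) ^ 2 - 1)
    (hcong : ∀ ℓ : ℕ, ℓ.Prime → ¬ (ℓ ∣ p * W.conductorNorm ℤ * G.conductorNorm ℤ) →
      ((W.LFunction ℓ : ℤ) : ZMod p) = ((G.LFunction ℓ : ℤ) : ZMod p)) :
    MissingLowerBoundAt W p :=
  (lower_and_upper_of_missingPPartAt W p
    (missingPPartAt_rankZero_of_fouquetFibreShape_levelNotOneModP W G p hA hmod hGZK hp hr hsurj hram hlev hord
      hnak hcong)).1

end ShapeWitnessPrime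

/-- **Row form over fact (A′) for the 19618 skeleton («FibreRowA′» = FibreRowA ∧ the R2′ binder): L₀ on every (t′)
rank-`0` row at `p ≥ 5` with `ρ̄` onto, a Steinberg prime `q ≢ ±1 (mod p)` with `p ∤ v_q(Δ_W)`, no bad prime
`ℓ ≠ p` with `ℓ ≡ 1 (mod p)`, and a congruent good-ordinary `G` with `p ∤ a_p(G)² − 1`.** Conditional on the
cite-level fact `hA`; nothing credited; items NOT closed.
[cite: Fouquet2024CongruencesIMC, Thm 1.1 (iv)⇒(ii) (p. 24), fibre (p. 29), Prop. 3.9 (p. 33)]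
[cite: SkinnerUrban2014, Thm 3.6.4 (p. 43)] [cite: Miller2011LMS, Def. 1.1] -/
theorem tameLowerHalf_fouquetFibreShapeRows_levelNotOneModP_of_fact
    (hA : Fouquet2024.padicValRat_bsd_rank_zero_of_ordinaryFibre_ellipticShape_levelNotOneModP)
    (hGZK : rank_eq_analyticRank_of_analyticRank_le_one) (hmod : hasEntireLFunction_rat) :
    ∀ (W : WeierstrassCurve ℚ) [W.IsElliptic] [W.IsGloballyMinimal] (p : ℕ) [Fact p.Prime],
      W.analyticRank = 0 → 5 ≤ p → Addv W p → SubTprime W p → Surj W p →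
      (∃ ℓ : ℕ, ∃ _ : Fact ℓ.Prime, ℓ ≠ p ∧ W.HasMultiplicativeReductionAtPrime ℓ ∧
        ¬ p ∣ padicValInt ℓ W.minimalDiscriminantInt ∧ ¬ p ∣ ℓ - 1 ∧ ¬ p ∣ ℓ + 1) →
      (∀ ℓ : ℕ, ℓ.Prime → ℓ ∣ W.conductorNorm ℤ → ℓ ≠ p → ¬ p ∣ ℓ - 1) →
      (∃ (G : WeierstrassCurve ℚ) (_ : G.IsElliptic) (_ : G.IsGloballyMinimal),
        GoodOrd G p ∧ ¬ (p : ℤ) ∣ (G.frobeniusTrace p) ^ 2 - 1 ∧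
        (∀ ℓ : ℕ, ℓ.Prime → ¬ (ℓ ∣ p * W.conductorNorm ℤ * G.conductorNorm ℤ) →
          ((W.LFunction ℓ : ℤ) : ZMod p) = ((G.LFunction ℓ : ℤ) : ZMod p))) →
      MissingLowerBoundAt W p := by
  intro W _ _ p _ hr hp _ _ hsurj hram hlev hG
  obtain ⟨G, hGe, hGm, hord, hnak, hcong⟩ := hG
  exact missingLowerBoundAt_rankZero_of_fouquetFibreShape_levelNotOneModP W G p hA hmod hGZK hp hr hsurj hram hlev
    hord hnak hcong

/-- **Both halves (`MissingPPartAt`) on the same rows («FibreRowA′»).** Conditional; nothing credited.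
[cite: Fouquet2024CongruencesIMC, Prop. 3.9 (p. 33)] [cite: Miller2011LMS, Def. 1.1] -/
theorem tameMissingPPartAt_fouquetFibreShapeRows_levelNotOneModP_of_fact
    (hA : Fouquet2024.padicValRat_bsd_rank_zero_of_ordinaryFibre_ellipticShape_levelNotOneModP)
    (hGZK : rank_eq_analyticRank_of_analyticRank_le_one) (hmod : hasEntireLFunction_rat) :
    ∀ (W : WeierstrassCurve ℚ) [W.IsElliptic] [W.IsGloballyMinimal] (p : ℕ) [Fact p.Prime],
      W.analyticRank = 0 → 5 ≤ p → Addv W p → SubTprime W p → Surj W p →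
      (∃ ℓ : ℕ, ∃ _ : Fact ℓ.Prime, ℓ ≠ p ∧ W.HasMultiplicativeReductionAtPrime ℓ ∧
        ¬ p ∣ padicValInt ℓ W.minimalDiscriminantInt ∧ ¬ p ∣ ℓ - 1 ∧ ¬ p ∣ ℓ + 1) →
      (∀ ℓ : ℕ, ℓ.Prime → ℓ ∣ W.conductorNorm ℤ → ℓ ≠ p → ¬ p ∣ ℓ - 1) →
      (∃ (G : WeierstrassCurve ℚ) (_ : G.IsElliptic) (_ : G.IsGloballyMinimal),
        GoodOrd G p ∧ ¬ (p : ℤ) ∣ (G.frobeniusTrace p) ^ 2 - 1 ∧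
        (∀ ℓ : ℕ, ℓ.Prime → ¬ (ℓ ∣ p * W.conductorNorm ℤ * G.conductorNorm ℤ) →
          ((W.LFunction ℓ : ℤ) : ZMod p) = ((G.LFunction ℓ : ℤ) : ZMod p))) →
      MissingPPartAt W p := by
  intro W _ _ p _ hr hp _ _ hsurj hram hlev hG
  obtain ⟨G, hGe, hGm, hord, hnak, hcong⟩ := hG
  exact missingPPartAt_rankZero_of_fouquetFibreShape_levelNotOneModP W G p hA hmod hGZK hp hr hsurj hram hlev hord
    hnak hcong

/-! ## §3 The SEED-FREE road over fact (B′) («FibreRowB′» = FibreRowB ∧ the R2′ binder) -/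

section LinePrime

variable (W : WeierstrassCurve ℚ) [W.IsElliptic] [W.IsGloballyMinimal] (p : ℕ) [Fact p.Prime]

/-- **Bridge (definitional) over fact (B′): print shape of the `p`-part of BSD in rank `0`** for `W` (any reduction at
`p ≥ 5`) with `ρ̄_{W,p}` onto, a Steinberg prime `q ≢ ±1 (mod p)` with `p ∤ v_q(Δ_W)`, NO bad prime `ℓ ≠ p` with
`ℓ ≡ 1 (mod p)` (R2′), and `Fouquet2024.HasOrdinaryLineNakamuraAt p W`. No partner, no Ass. 3.4. Conditional on the
cite-level fact `hB`; nothing credited. [cite: Fouquet2024CongruencesIMC, Thm 1.1 (iv)⇒(ii) (p. 24), fibre (p. 29), Prop. 3.9 (p. 33), §4.1 (p. 38)]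
[cite: Nakamura2023ZetaMorphisms, Thm 1.1 (4)(5)] -/
theorem pPartRankZero_of_fouquetFibreLine_levelNotOneModP
    (hB : Fouquet2024.padicValRat_bsd_rank_zero_of_ordinaryFibre_levelNotOneModP) (hp : 5 ≤ p) (hsurj : Surj W p)
    (hram : ∃ ℓ : ℕ, ∃ _ : Fact ℓ.Prime, ℓ ≠ p ∧ W.HasMultiplicativeReductionAtPrime ℓ ∧
      ¬ p ∣ padicValInt ℓ W.minimalDiscriminantInt ∧ ¬ p ∣ ℓ - 1 ∧ ¬ p ∣ ℓ + 1)
    (hlev : ∀ ℓ : ℕ, ℓ.Prime → ℓ ∣ W.conductorNorm ℤ → ℓ ≠ p → ¬ p ∣ ℓ - 1)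
    (hline : Fouquet2024.HasOrdinaryLineNakamuraAt p W) (hL : W.entireLFunction 1 ≠ 0) (hfin : Finite W.sha) :
    PPartRankZero W p :=
  hB W p hp hsurj hram hlev hline hL hfin

/-- **Both typed halves `MissingPPartAt W p` over fact (B′)** (+ modularity + GZK), seed-free. Conditional; nothing
credited. [cite: Fouquet2024CongruencesIMC, Thm 1.1 (p. 24) and Prop. 3.9 (p. 33)] [cite: Miller2011LMS, Def. 1.1] -/
theorem missingPPartAt_rankZero_of_fouquetFibreLine_levelNotOneModP
    (hB : Fouquet2024.padicValRat_bsd_rank_zero_of_ordinaryFibre_levelNotOneModP) (hmod : hasEntireLFunction_rat)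
    (hGZK : rank_eq_analyticRank_of_analyticRank_le_one) (hp : 5 ≤ p) (hr : W.analyticRank = 0)
    (hsurj : Surj W p)
    (hram : ∃ ℓ : ℕ, ∃ _ : Fact ℓ.Prime, ℓ ≠ p ∧ W.HasMultiplicativeReductionAtPrime ℓ ∧
      ¬ p ∣ padicValInt ℓ W.minimalDiscriminantInt ∧ ¬ p ∣ ℓ - 1 ∧ ¬ p ∣ ℓ + 1)
    (hlev : ∀ ℓ : ℕ, ℓ.Prime → ℓ ∣ W.conductorNorm ℤ → ℓ ≠ p → ¬ p ∣ ℓ - 1)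
    (hline : Fouquet2024.HasOrdinaryLineNakamuraAt p W) : MissingPPartAt W p := by
  haveI hfin : Finite W.sha := (hGZK W (by omega)).2
  have hL : W.entireLFunction 1 ≠ 0 := by
    rw [← W.leadingLCoeff_eq_of_analyticRank_eq_zero hr]
    exact W.leadingLCoeff_ne_zero_holds (hmod W)
  exact missingPPartAt_of_bsdp W p
    (bsdp_of_pPartRankZero W p hmod hGZK hr
      (pPartRankZero_of_fouquetFibreLine_levelNotOneModP W p hB hp hsurj hram hlev hline hL hfin))

/-- **The crux's currency `MissingLowerBoundAt W p` over fact (B′)**, seed-free. Conditional; items NOT closed.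
[cite: Fouquet2024CongruencesIMC, Thm 1.1 (p. 24)] [cite: Miller2011LMS, Def. 1.1] -/
theorem missingLowerBoundAt_rankZero_of_fouquetFibreLine_levelNotOneModP
    (hB : Fouquet2024.padicValRat_bsd_rank_zero_of_ordinaryFibre_levelNotOneModP) (hmod : hasEntireLFunction_rat)
    (hGZK : rank_eq_analyticRank_of_analyticRank_le_one) (hp : 5 ≤ p) (hr : W.analyticRank = 0)
    (hsurj : Surj W p)
    (hram : ∃ ℓ : ℕ, ∃ _ : Fact ℓ.Prime, ℓ ≠ p ∧ W.HasMultiplicativeReductionAtPrime ℓ ∧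
      ¬ p ∣ padicValInt ℓ W.minimalDiscriminantInt ∧ ¬ p ∣ ℓ - 1 ∧ ¬ p ∣ ℓ + 1)
    (hlev : ∀ ℓ : ℕ, ℓ.Prime → ℓ ∣ W.conductorNorm ℤ → ℓ ≠ p → ¬ p ∣ ℓ - 1)
    (hline : Fouquet2024.HasOrdinaryLineNakamuraAt p W) : MissingLowerBoundAt W p :=
  (lower_and_upper_of_missingPPartAt W p
    (missingPPartAt_rankZero_of_fouquetFibreLine_levelNotOneModP W p hB hmod hGZK hp hr hsurj hram hlev hline)).1

end LinePrime

/-- **Row form over fact (B′) for the 19618 skeleton («FibreRowB′», SEED-FREE, CLASS-LEVEL): L₀ on every (t′)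
rank-`0` row at `p ≥ 5` with `ρ̄` onto, a Steinberg prime `q ≢ ±1 (mod p)` with `p ∤ v_q(Δ_W)`, no bad prime
`ℓ ≠ p` with `ℓ ≡ 1 (mod p)`, and an ordinary residual line at `p` with Nakamura's condition.** Conditional on the
cite-level fact `hB`; nothing credited; items NOT closed.
[cite: Fouquet2024CongruencesIMC, Thm 1.1 (iv)⇒(ii) (p. 24), fibre (p. 29), Prop. 3.9 (p. 33), §4.2 (p. 39)]
[cite: SkinnerUrban2014, Thm 3.6.4 (p. 43)] [cite: Miller2011LMS, Def. 1.1] -/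
theorem tameLowerHalf_fouquetFibreLineRows_levelNotOneModP_of_fact
    (hB : Fouquet2024.padicValRat_bsd_rank_zero_of_ordinaryFibre_levelNotOneModP)
    (hGZK : rank_eq_analyticRank_of_analyticRank_le_one) (hmod : hasEntireLFunction_rat) :
    ∀ (W : WeierstrassCurve ℚ) [W.IsElliptic] [W.IsGloballyMinimal] (p : ℕ) [Fact p.Prime],
      W.analyticRank = 0 → 5 ≤ p → Addv W p → SubTprime W p → Surj W p →
      (∃ ℓ : ℕ, ∃ _ : Fact ℓ.Prime, ℓ ≠ p ∧ W.HasMultiplicativeReductionAtPrime ℓ ∧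
        ¬ p ∣ padicValInt ℓ W.minimalDiscriminantInt ∧ ¬ p ∣ ℓ - 1 ∧ ¬ p ∣ ℓ + 1) →
      (∀ ℓ : ℕ, ℓ.Prime → ℓ ∣ W.conductorNorm ℤ → ℓ ≠ p → ¬ p ∣ ℓ - 1) →
      Fouquet2024.HasOrdinaryLineNakamuraAt p W → MissingLowerBoundAt W p := by
  intro W _ _ p _ hr hp _ _ hsurj hram hlev hline
  exact missingLowerBoundAt_rankZero_of_fouquetFibreLine_levelNotOneModP W p hB hmod hGZK hp hr hsurj hram hlev hline

/-- **Both halves (`MissingPPartAt`) on the same rows («FibreRowB′», seed-free).** Conditional; nothing credited.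
[cite: Fouquet2024CongruencesIMC, Prop. 3.9 (p. 33)] [cite: Miller2011LMS, Def. 1.1] -/
theorem tameMissingPPartAt_fouquetFibreLineRows_levelNotOneModP_of_fact
    (hB : Fouquet2024.padicValRat_bsd_rank_zero_of_ordinaryFibre_levelNotOneModP)
    (hGZK : rank_eq_analyticRank_of_analyticRank_le_one) (hmod : hasEntireLFunction_rat) :
    ∀ (W : WeierstrassCurve ℚ) [W.IsElliptic] [W.IsGloballyMinimal] (p : ℕ) [Fact p.Prime],
      W.analyticRank = 0 → 5 ≤ p → Addv W p → SubTprime W p → Surj W p →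
      (∃ ℓ : ℕ, ∃ _ : Fact ℓ.Prime, ℓ ≠ p ∧ W.HasMultiplicativeReductionAtPrime ℓ ∧
        ¬ p ∣ padicValInt ℓ W.minimalDiscriminantInt ∧ ¬ p ∣ ℓ - 1 ∧ ¬ p ∣ ℓ + 1) →
      (∀ ℓ : ℕ, ℓ.Prime → ℓ ∣ W.conductorNorm ℤ → ℓ ≠ p → ¬ p ∣ ℓ - 1) →
      Fouquet2024.HasOrdinaryLineNakamuraAt p W → MissingPPartAt W p := by
  intro W _ _ p _ hr hp _ _ hsurj hram hlev hline
  exact missingPPartAt_rankZero_of_fouquetFibreLine_levelNotOneModP W p hB hmod hGZK hp hr hsurj hram hlev hline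

end Summit.BirchSwinnertonDyer.BirchSwinnertonDyer.Theorems

end
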